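import Mathlib
import Summits.Ventures.PercRepro2.SwOutAll
import Summits.Ventures.PercRepro2.SwOutSeriesDefs
import Summits.Ventures.PercRepro2.SwOutLeaf

/-!
# Peeling a leaf inside an outside class, part 2: edge sets, counts and THEOREM L (blind cell
PercRepro2, night-4 g10, 2026-08-25; proofs/NIGHT4-G10.md §2, Remark (i))

`redEdges_deleteLeaf` / `blueEdges_deleteLeaf`: the edge sets of the clusters of `h` in `G` are
those of `G − u` tagged by the leaf edge when it has the cluster's colour; `card_filter_leaf_eq`: the
configurations with a prescribed colour at the leaf edge are in bijection with the peeled class;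
**`card_le_of_leaf`** (THEOREM L): the rigid counting inequalities of the peeled class, for every
up-set, give those of the class — the leaf step of the induction of the cycle theorem.
-/

namespace Summit.Ventures.PercRepro2

namespace LocRows

open Hull

variable {V : Type*} {E : Type*} [Fintype E] [DecidableEq E]

open scoped Classical

variable {ends : E → Sym2 V} {u p : V} {e₁ : E}

section LeafThm

variable (hs : IsLeafAt ends u p e₁)
include hs

/-- **The red edge set under the peel**: the red edges of `C_R(h)` in `G` are those in `G − u`
tagged by `e₁` at `p` when `e₁` is red, and unchanged when `e₁` is blue. -/
theorem redEdges_deleteLeaf {h : V} (huh : u ≠ h) {ζ : Config E} (b : Bool) :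
    redEdges ends ζ h =
      if ζ e₁ = true then
        tagSub (deleteLeaf ends u e₁) h e₁ p (redEdges (deleteLeaf ends u e₁) (Function.update ζ e₁ b) h)
      else redEdges (deleteLeaf ends u e₁) (Function.update ζ e₁ b) h := by
  set ends' := deleteLeaf ends u e₁ with hends'
  set ζ' := Function.update ζ e₁ b with hζ'
  have hC : ∀ v, v ≠ u → (v ∈ cluster ends ζ h ↔ v ∈ cluster ends' ζ' h) :=
    fun v hv => mem_cluster_deleteLeaf_iff hs b huh.symm hv
  have hCu : u ∈ cluster ends ζ h ↔ (ζ e₁ = true ∧ p ∈ cluster ends' ζ' h) :=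
    mem_cluster_deleteLeaf_u_iff hs b huh.symm
  have hu' : u ∉ cluster ends' ζ' h := u_notMem_cluster_deleteLeaf hs huh.symm
  have hR1 : e₁ ∉ within ends' (cluster ends' ζ' h) := by
    rw [within_iff_of_ends (deleteLeaf_apply_e₁ (ends := ends) (u := u) (e₁ := e₁))]
    exact fun h' => hu' h'.1
  have hclu : cluster ends' ζ' h = insert h {x | ∃ e ∈ redEdges ends' ζ' h, x ∈ ends' e} :=
    cluster_eq_insert_ends_redEdges ζ' h
  have hL1 : e₁ ∈ within ends (cluster ends ζ h) ↔ u ∈ cluster ends ζ h ∧ p ∈ cluster ends ζ h :=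
    within_iff_of_ends hs.ends₁
  -- the common part: edges other than `e₁`
  have hother : ∀ e, e ≠ e₁ → (e ∈ redEdges ends ζ h ↔ e ∈ redEdges ends' ζ' h) := by
    intro e he₁
    rw [mem_redEdges, mem_redEdges]
    have hζ'e : ζ' e = ζ e := Function.update_of_ne he₁ b ζ
    have hends'e : ends' e = ends e := deleteLeaf_apply_of_ne he₁
    rw [hζ'e]
    constructor
    · rintro ⟨he, x, hx, y, hy, hxy⟩
      have hxu : x ≠ u := ne_u_of_mem_ends_leaf hs he₁ (by rw [hxy]; exact Sym2.mem_mk_left x y)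
      have hyu : y ≠ u := ne_u_of_mem_ends_leaf hs he₁ (by rw [hxy]; exact Sym2.mem_mk_right x y)
      exact ⟨he, x, (hC x hxu).1 hx, y, (hC y hyu).1 hy, by rw [hends'e]; exact hxy⟩
    · rintro ⟨he, x, hx, y, hy, hxy⟩
      rw [hends'e] at hxy
      have hxu : x ≠ u := ne_u_of_mem_ends_leaf hs he₁ (by rw [hxy]; exact Sym2.mem_mk_left x y)
      have hyu : y ≠ u := ne_u_of_mem_ends_leaf hs he₁ (by rw [hxy]; exact Sym2.mem_mk_right x y)
      exact ⟨he, x, (hC x hxu).2 hx, y, (hC y hyu).2 hy, hxy⟩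
  have he₁R : e₁ ∉ redEdges ends' ζ' h := fun h' => hR1 h'.2
  split_ifs with h₁
  · ext e
    rw [mem_tagSub_iff]
    by_cases he₁ : e = e₁
    · subst e
      rw [mem_redEdges, hL1]
      constructor
      · rintro ⟨_, hu, _⟩
        exact Or.inr ⟨rfl, by rw [← hclu]; exact (hCu.1 hu).2⟩
      · rintro (h' | ⟨_, hp⟩)
        · exact absurd h' he₁R
        · rw [← hclu] at hp
          exact ⟨h₁, hCu.2 ⟨h₁, hp⟩, (hC p hs.up.symm).2 hp⟩
    · simp only [he₁, false_and, or_false]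
      exact hother e he₁
  · ext e
    by_cases he₁ : e = e₁
    · subst e
      simp only [mem_redEdges, h₁, Bool.false_eq_true, false_and, false_iff]
      exact he₁R
    · exact hother e he₁

/-- **The blue edge set under the peel.** -/
theorem blueEdges_deleteLeaf {h : V} (huh : u ≠ h) {ζ : Config E} :
    blueEdges ends ζ h =
      if ζ e₁ = false then
        tagSub (deleteLeaf ends u e₁) h e₁ p
          (blueEdges (deleteLeaf ends u e₁) (Function.update ζ e₁ false) h)
      else blueEdges (deleteLeaf ends u e₁) (Function.update ζ e₁ false) h := by
  unfold blueEdges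
  rw [blue_update]
  have := redEdges_deleteLeaf hs huh (ζ := blue ζ) true
  rw [this]
  have hb : (blue ζ e₁ = true) = (ζ e₁ = false) := by
    simp [blue]
  simp only [hb]
  rfl

/-- **The configurations with a prescribed colour at the leaf edge are in bijection with the peeled
class**, for predicates corresponding under `ζ ↦ ζ[e₁ ↦ false]`. -/
theorem card_filter_leaf_eq {U : Set V} {ξ : Config E} {l h o : V} (hu : u ∈ U) (huh : u ≠ h)
    (hul : u ≠ l) (huo : u ≠ o) (c : Bool) (P : Config E → Prop) (P' : Config E → Prop)
    (hPP : ∀ ζ, ζ e₁ = c → (P ζ ↔ P' (Function.update ζ e₁ false))) :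
    ((swOutSide ends l h o U ξ).filter fun ζ => ζ e₁ = c ∧ P ζ).card =
      ((swOutSide (deleteLeaf ends u e₁) l h o (U \ {u})
        (Function.update ξ e₁ false)).filter fun ζ' => P' ζ').card := by
  refine Finset.card_bij (fun ζ _ => Function.update ζ e₁ false) ?_ ?_ ?_
  · intro ζ hζ
    rw [Finset.mem_filter] at hζ ⊢
    obtain ⟨hζ, h₁, hP⟩ := hζ
    exact ⟨(mem_swOutSide_deleteLeaf_iff hs hu huh hul huo).1 hζ, (hPP ζ h₁).1 hP⟩
  · intro ζ₁ hζ₁ ζ₂ hζ₂ heq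
    rw [Finset.mem_filter] at hζ₁ hζ₂
    funext e
    by_cases he₁ : e = e₁
    · subst e; rw [hζ₁.2.1, hζ₂.2.1]
    · have := congrFun heq e
      rwa [Function.update_of_ne he₁, Function.update_of_ne he₁] at this
  · intro ζ' hζ'
    rw [Finset.mem_filter] at hζ'
    have hmem := (mem_swOutSide.1 hζ'.1).2
    rw [mem_outClass] at hmem
    have hpin : ζ' e₁ = false := by
      have := hmem.1 e₁ (by rw [mem_touches_deleteLeaf_iff hs]; exact fun h' => h'.2 rfl)
      rw [this]; simp
    refine ⟨Function.update ζ' e₁ c, ?_, ?_⟩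
    · have h₁ : Function.update ζ' e₁ c e₁ = c := by simp
      have hback : Function.update (Function.update ζ' e₁ c) e₁ false = ζ' := by
        rw [Function.update_idem]
        exact Function.update_eq_self_iff.2 hpin.symm
      rw [Finset.mem_filter]
      refine ⟨?_, h₁, ?_⟩
      · rw [mem_swOutSide_deleteLeaf_iff hs hu huh hul huo, hback]
        exact hζ'.1
      · rw [hPP _ h₁, hback]
        exact hζ'.2
    · rw [Function.update_idem]
      exact Function.update_eq_self_iff.2 hpin.symm

omit [Fintype E] [DecidableEq E] hs in
/-- The two-way split of a filtered count by the colour of one edge. -/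
lemma card_filter_split_leaf (S : Finset (Config E)) (P : Config E → Prop) :
    (S.filter fun ζ => P ζ).card =
      (S.filter fun ζ => ζ e₁ = true ∧ P ζ).card + (S.filter fun ζ => ζ e₁ = false ∧ P ζ).card := by
  have h1 := Finset.card_filter_add_card_filter_not (s := S.filter fun ζ => P ζ)
    (fun ζ => ζ e₁ = true)
  simp only [Finset.filter_filter] at h1
  have e1 : (S.filter fun ζ => P ζ ∧ ζ e₁ = true) = S.filter fun ζ => ζ e₁ = true ∧ P ζ := by
    apply Finset.filter_congr; intro ζ _; exact and_comm
  have e2 : (S.filter fun ζ => P ζ ∧ ¬ ζ e₁ = true) = S.filter fun ζ => ζ e₁ = false ∧ P ζ := by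
    apply Finset.filter_congr; intro ζ _
    constructor
    · rintro ⟨hP, h₁⟩
      exact ⟨by cases h : ζ e₁ <;> simp_all, hP⟩
    · rintro ⟨h₁, hP⟩
      exact ⟨hP, by rw [h₁]; decide⟩
  rw [e1, e2] at h1
  omega

/-- **THEOREM L (peeling a leaf inside an outside class)**: the rigid counting inequalities of the
peeled class `(G − u, U ∖ {u}, ξ[e₁ ↦ false])`, for every up-set, give those of the class
`(G, U, ξ)`. -/
theorem card_le_of_leaf {U : Set V} {ξ : Config E} {l h o : V} (hu : u ∈ U) (huh : u ≠ h)
    (hul : u ≠ l) (huo : u ≠ o)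
    (ih : ∀ 𝓔 : Set (Set E), IsUpperSet 𝓔 →
      ((swOutSide (deleteLeaf ends u e₁) l h o (U \ {u})
          (Function.update ξ e₁ false)).filter fun ζ' =>
            redEdges (deleteLeaf ends u e₁) ζ' h ∈ 𝓔).card ≤
        ((swOutSide (deleteLeaf ends u e₁) l h o (U \ {u})
          (Function.update ξ e₁ false)).filter fun ζ' =>
            blueEdges (deleteLeaf ends u e₁) ζ' h ∈ 𝓔).card)
    {𝓔 : Set (Set E)} (h𝓔 : IsUpperSet 𝓔) :
    ((swOutSide ends l h o U ξ).filter fun ζ => redEdges ends ζ h ∈ 𝓔).card ≤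
      ((swOutSide ends l h o U ξ).filter fun ζ => blueEdges ends ζ h ∈ 𝓔).card := by
  rw [card_filter_split_leaf (e₁ := e₁) (swOutSide ends l h o U ξ)
      (fun ζ => redEdges ends ζ h ∈ 𝓔),
    card_filter_split_leaf (e₁ := e₁) (swOutSide ends l h o U ξ)
      (fun ζ => blueEdges ends ζ h ∈ 𝓔)]
  have hrT := card_filter_leaf_eq hs (U := U) (ξ := ξ) hu huh hul huo true (fun ζ => redEdges ends ζ h ∈ 𝓔)
    (fun ζ' => redEdges (deleteLeaf ends u e₁) ζ' h ∈ tagSub (deleteLeaf ends u e₁) h e₁ p ⁻¹' 𝓔)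
    (fun ζ h₁ => by rw [Set.mem_preimage, redEdges_deleteLeaf hs huh (ζ := ζ) false, if_pos h₁])
  have hrF := card_filter_leaf_eq hs (U := U) (ξ := ξ) hu huh hul huo false (fun ζ => redEdges ends ζ h ∈ 𝓔)
    (fun ζ' => redEdges (deleteLeaf ends u e₁) ζ' h ∈ 𝓔)
    (fun ζ h₁ => by rw [redEdges_deleteLeaf hs huh (ζ := ζ) false, if_neg (by rw [h₁]; decide)])
  have hbT := card_filter_leaf_eq hs (U := U) (ξ := ξ) hu huh hul huo true (fun ζ => blueEdges ends ζ h ∈ 𝓔)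
    (fun ζ' => blueEdges (deleteLeaf ends u e₁) ζ' h ∈ 𝓔)
    (fun ζ h₁ => by rw [blueEdges_deleteLeaf hs huh (ζ := ζ), if_neg (by rw [h₁]; decide)])
  have hbF := card_filter_leaf_eq hs (U := U) (ξ := ξ) hu huh hul huo false (fun ζ => blueEdges ends ζ h ∈ 𝓔)
    (fun ζ' => blueEdges (deleteLeaf ends u e₁) ζ' h ∈ tagSub (deleteLeaf ends u e₁) h e₁ p ⁻¹' 𝓔)
    (fun ζ h₁ => by rw [Set.mem_preimage, blueEdges_deleteLeaf hs huh (ζ := ζ), if_pos h₁])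
  rw [hrT, hrF, hbT, hbF]
  have h1 := ih _ (isUpperSet_preimage_tagSub (ends := deleteLeaf ends u e₁) (h := h) (e₀ := e₁)
    (p := p) h𝓔)
  have h2 := ih _ h𝓔
  omega

end LeafThm

end LocRows

end Summit.Ventures.PercRepro2
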